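import Summits.ResolutionOfSingularities.ResolutionOfSingularities.Theorems.HilbertSamuelEliminationSigmaMaxModificationsCorridor3TameWildStubIsolatedNu3
import Mathlib.AlgebraicGeometry.Morphisms.Proper
import Mathlib.AlgebraicGeometry.Noetherian
import HarnessLib

/-!
# Route `HilbertSamuelElimination`, crux `SigmaMaxModificationsCorridor3`
# (stmt-ResolutionOfSingularities-19249; child of `SigmaMaxModifications` stmt-…-18506),
# line `tame_wild` — a MINIMAL SINGULAR VALUE has an isolated stratum

[OURS · L1 W4.2] A topological supplement to the landed stub `stub_isolatedNu3` (p459425), reducing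
the isolation hypothesis of that stub to a statement about the VALUE `ν` alone. NOT a statement of any
manuscript.

* `disjoint_closure_singular_of_isMin_singular_value` — for `Y` locally of finite type and
  quasi-compact over a field, `dim Y ≤ N`, and a value `ν` below which no SINGULAR value of `H^N_Y`
  lies (`∀ y ∉ Reg Y, H^N_Y(y) ≤ ν → H^N_Y(y) = ν`), the stratum `Y(ν)` is disjoint from
  `closure (Sing Y ∖ Y(ν))`. Proof: every `Y(≥ μ)` is closed (sharp upper semicontinuity at
  `N ≥ dim Y` over a field, landed `stub_isClosed_hsMaxLocus_over_field` ∘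
  `stub_hsFun_le_of_specializes_over_field`) and `Σ_Y(N)` is finite
  (`Scheme.finite_hsValues_of_isExcellent`), so `U := Y ∖ ⋃_{μ ∈ Σ_Y(N), μ ≰ ν} Y(≥ μ)` is an open
  neighbourhood of `Y(ν)` on which `H^N_Y ≤ ν`; a singular point of `U` then has value `ν`, so `U`
  misses `Sing Y ∖ Y(ν)` (CJS Lemma 2.36 (a) bookkeeping).
* `nuMod_dim_le_three_of_isMin_singular_value` — hence (conditional on Cossart–Piltant 2019) every
  maximal value `ν ≠ Φ^{(N)}` of `Σ_Y(N)`, `dim Y ≤ 3`, `dim Y ≤ N`, which is MINIMAL among the singular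
  values admits a `ν`-modification at level `N` inside the class `{dim ≤ 3}`
  (`nuMod_dim_le_three_of_isolated`). Intended use (crux plan H-programme): the multiplicity-`2`
  hypersurface value `hypersurfaceHF 2` — once the Hilbert-function classification "no singular
  value of a reduced threefold lies strictly below `hypersurfaceHF 2`" (ring level, H1-family) is
  landed, the tame regime at `p = 3` (`m < 3`) is covered by the isolated regime.

## Sources

* V. Cossart, U. Jannsen, S. Saito, LNM 2270 (2020), Thm. 2.33, Lemma 2.36, Def. 6.14.
  [CossartJannsenSaito2020]
* V. Cossart, O. Piltant, J. Algebra 529 (2019), Thm. 1.1. [CossartPiltant2019]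
-/

set_option linter.dupNamespace false -- mandated namespace of this single-conjunct summit

noncomputable section

open CategoryTheory AlgebraicGeometry TopologicalSpace Topology
open Literature.AlgebraicGeometry.Resolution Literature.RingTheory.HilbertSamuel
open Summit.ResolutionOfSingularities.ResolutionOfSingularities.Theorems.SigmaMaxModifications.Sketch

namespace Summit.ResolutionOfSingularities.ResolutionOfSingularities.Theorems.SigmaMaxModificationsCorridor3.TameWild

/-- **A minimal singular value has an isolated stratum.** For `Y` locally of finite type and
quasi-compact over a field `k`, `dim Y ≤ N`, and `ν : ℕ → ℕ` such that every SINGULAR point `y` with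
`H^N_Y(y) ≤ ν` has `H^N_Y(y) = ν`: `Y(ν)` is disjoint from `closure (Sing Y ∖ Y(ν))`. The open
`U = Y ∖ ⋃_{μ ∈ Σ_Y(N), μ ≰ ν} Y(≥ μ)` (finitely many closed sets: `Σ_Y(N)` is finite and `H^N_Y` is
upper semicontinuous at `N ≥ dim Y` over a field) contains `Y(ν)`, and `H^N_Y ≤ ν` on `U`, so `U`
misses `Sing Y ∖ Y(ν)`. [cite: CossartJannsenSaito2020, Thm. 2.33, Lemma 2.36 (a)] -/
theorem disjoint_closure_singular_of_isMin_singular_value {k : Type} [Field k] {Y : Scheme.{0}}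
    (g : Y ⟶ Spec (.of k)) [LocallyOfFiniteType g] [QuasiCompact g] {N : ℕ}
    (hdim : topologicalKrullDim Y ≤ (N : WithBot ℕ∞)) {ν : ℕ → ℕ}
    (hmin : ∀ y : Y, y ∉ Scheme.regularLocus Y → Scheme.hsFun Y N y ≤ ν → Scheme.hsFun Y N y = ν) :
    Disjoint (closure ((Scheme.regularLocus Y)ᶜ \ Scheme.hsStratum Y N ν))
      (Scheme.hsStratum Y N ν) := by
  haveI : IsLocallyNoetherian Y := LocallyOfFiniteType.isLocallyNoetherian g
  haveI : IsNoetherian Y := Scheme.isNoetherian_of_finiteType_over_field g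
  have hexc : Scheme.IsExcellent Y :=
    Scheme.isExcellent_of_locallyOfFiniteType Stacks07QW_field_holds g
  have hψ : ∀ y : Y, Scheme.hsPsi Y y ≤ N :=
    Summit.ResolutionOfSingularities.ResolutionOfSingularities.Theorems.SigmaMaxModifications.Negative.hsPsi_le_of_dim_le
      hdim
  -- upper semicontinuity and finiteness of the values
  have husc : ∀ μ : ℕ → ℕ, IsClosed (Scheme.hsStratumGE Y N μ) :=
    (stub_isClosed_hsMaxLocus_over_field stub_hsFun_le_of_specializes_over_field k Y g
      inferInstance inferInstance N hdim).1
  have hfin : (Scheme.hsValues Y N).Finite := Scheme.finite_hsValues_of_isExcellent hexc N hψ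
  -- the open neighbourhood `U` of `Y(ν)` on which `H ≤ ν`
  let S : Set (ℕ → ℕ) := {μ | μ ∈ Scheme.hsValues Y N ∧ ¬ μ ≤ ν}
  have hSfin : S.Finite := hfin.subset fun μ hμ => hμ.1
  let U : Set Y := ⋂ μ ∈ S, (Scheme.hsStratumGE Y N μ)ᶜ
  have hUopen : IsOpen U := hSfin.isOpen_biInter fun μ _ => (husc μ).isOpen_compl
  have hle : ∀ y ∈ U, Scheme.hsFun Y N y ≤ ν := by
    intro y hy
    by_contra hyν
    have hyS : Scheme.hsFun Y N y ∈ S := ⟨⟨y, rfl⟩, hyν⟩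
    have := Set.mem_iInter₂.mp hy _ hyS
    exact this (Scheme.hsStratum_subset_hsStratumGE N _ (Scheme.mem_hsStratum_hsFun N y))
  have hνU : Scheme.hsStratum Y N ν ⊆ U := by
    intro x hx
    rw [Scheme.mem_hsStratum_iff] at hx
    refine Set.mem_iInter₂.mpr fun μ hμ hxμ => hμ.2 ?_
    rw [Scheme.mem_hsStratumGE_iff, hx] at hxμ
    exact hxμ
  -- `U` misses `Sing Y ∖ Y(ν)`
  have hmiss : U ∩ ((Scheme.regularLocus Y)ᶜ \ Scheme.hsStratum Y N ν) = ∅ := by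
    ext y
    simp only [Set.mem_inter_iff, Set.mem_sdiff, Set.mem_compl_iff, Set.mem_empty_iff_false,
      iff_false, not_and, not_not]
    intro hyU hyreg
    exact hmin y hyreg (hle y hyU)
  rw [Set.disjoint_iff_inter_eq_empty, Set.eq_empty_iff_forall_notMem]
  rintro x ⟨hxcl, hx⟩
  have hxU : x ∈ U := hνU hx
  rw [mem_closure_iff] at hxcl
  obtain ⟨y, hyU, hy⟩ := hxcl U hUopen hxU
  have : y ∈ U ∩ ((Scheme.regularLocus Y)ᶜ \ Scheme.hsStratum Y N ν) := ⟨hyU, hy⟩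
  rw [hmiss] at this
  exact this

/-- **`ν`-modifications for maximal values that are MINIMAL among the singular values** (conditional
on Cossart–Piltant 2019, Thm. 1.1): for `Y/k` reduced, separated, locally of finite type and
quasi-compact, `dim Y ≤ 3`, `dim Y ≤ N`, a maximal value `ν ≠ Φ^{(N)}` of `Σ_Y(N)` below which no
singular value lies admits a `ν`-modification at level `N` inside the class `{dim ≤ 3}` — its stratum
is isolated (`disjoint_closure_singular_of_isMin_singular_value`), so the landed
`nuMod_dim_le_three_of_isolated` applies. [cite: CossartPiltant2019, Thm. 1.1]
[cite: CossartJannsenSaito2020, Def. 6.14, Lemma 2.36] -/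
theorem nuMod_dim_le_three_of_isMin_singular_value (hCP : CossartPiltant2019General.{0})
    {k : Type} [Field k] {Y : Scheme.{0}} (g : Y ⟶ Spec (.of k)) [IsSeparated g]
    [LocallyOfFiniteType g] [QuasiCompact g] [IsReduced Y]
    (hdim3 : topologicalKrullDim Y ≤ ((3 : ℕ) : WithBot ℕ∞)) {N : ℕ}
    (hdim : topologicalKrullDim Y ≤ (N : WithBot ℕ∞)) {ν : ℕ → ℕ}
    (hν : Maximal (· ∈ Scheme.hsValues Y N) ν) (hνΦ : ν ≠ iterPSum N Phi)
    (hmin : ∀ y : Y, y ∉ Scheme.regularLocus Y → Scheme.hsFun Y N y ≤ ν → Scheme.hsFun Y N y = ν) :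
    NuMod Y N 3 ν :=
  nuMod_dim_le_three_of_isolated hCP g hdim3 hdim hν hνΦ
    (disjoint_closure_singular_of_isMin_singular_value g hdim hmin)

end Summit.ResolutionOfSingularities.ResolutionOfSingularities.Theorems.SigmaMaxModificationsCorridor3.TameWild

end
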